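import Summits.ValiantsHypothesis.ValiantsHypothesis.Theorems.KPlusLogSqLawTropicalBCyclePotential
import Summits.ValiantsHypothesis.ValiantsHypothesis.Theorems.KPlusLogSqLawTropicalBSplitDefs

/-!
# Route «KPlusLogSqLaw», crux `TropicalB` (stmt-ValiantsHypothesis-19771) — THE CYCLE POTENTIAL LAW, part 3: THE DEGREE BOUND IS AN
# ORDER-TYPE INVARIANT (`c = m`: no orbit hypothesis at all)

HONEST FRAMING.  Helper toward the registered stubs `stub_tropThin` / `stub_tropFat` of `Cruxes/TropicalB/Lines/birth.lean` (crux
`Summit.ValiantsHypothesis.ValiantsHypothesis.Theses.KPlusLogSqLaw.TropicalB`, item stmt-ValiantsHypothesis-19771, route KPlusLogSqLaw;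
cell `pub-symmetroid`, seat val-sym-trop-p1 g24, 2026-08-29; `--supports … --as helper`).  Corollaries of part 2 (`…TropicalBCyclePotential`,
`CyclePotential.chain_le`); structure statements about arbitrary designs, no census row of the crux; nothing here bears on `TropicalB` in its
window, `WeakLifting`, DoorA26 / DoorA34, `MatrixDescartes` (stmt-ValiantsHypothesis-18050) or VP ≠ VNP.

THE POINT.  In the cycle potential law the orbit hypothesis is void at `c = m` (the whole column set is invariant), so for EVERY design and
EVERY dominant chain:

* `compatible_of_univ` — a class potential `u` that induces the same STRICT order as `d` on full class maps
  (`Σ_b d (f b) < Σ_b d (g b) ⇒ Σ_b u (f b) < Σ_b u (g b)` for all `f g : Fin m → Fin K`) is `c`-compatible for every `c` (pad both maps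
  equally off the column set);
* `chain_le_orderType` / `chain_le_orderType_alt` — **`n ≤ m·(U₁ − U₀)` for every such `u` with values in `[U₀, U₁]`**: the tree's tropical
  DEGREE BOUND `n ≤ m·(max d − min d)` (`chain_le_mul_spread`, …TropicalBThinRanges; the case `u = d`) holds with the exponent vector replaced
  by ANY integer vector inducing the same strict order on `m`-column class sums — the bound is an invariant of the ORDER TYPE of `d` on
  `m`-multisets, not of its size.  (This is NOT the trivial remark that an order-equivalent exponent vector has the same chains — it does not:
  dominance compares slope differences with valuation differences; only the potential argument transfers.)
* `designRowD_orderType` — the same in the cell's census currency: `DesignRowD d v ε (m·H)` for every design `(d, v, ε)` whenever some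
  order-equivalent `u` has height `H`;
* `chain_le_resets` — the law WITH RESETS (general `c`, exceptional steps `J` with unrestricted orbits):
  `n ≤ #J + m(U₁ − U₀) + Σ_{k∈J} (Φ(p_k) − Φ(p_{k+1}))` — an exceptional step costs exactly its potential drop (refines part 2's
  `chain_le_of_exceptions`, which uses the crude drop bound `m(U₁ − U₀)`).

Located (hub, exact, seat folder py/compat.py; docstring only): least heights of order-equivalent vectors for the census exponents —
GRW `(6,4)` `d = (0,49,56,57)`: `43` (spread `57`); tight `(5,4)` `d = (0,7,22,34)`: `34` (= spread); lex `(4,4)` `d = (0,1,5,25)`: `21`;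
`(3,5)` `d = (0,9,12,13,40)`: `40`.  [this file]
-/

set_option linter.dupNamespace false
set_option autoImplicit false

namespace Summit.ValiantsHypothesis.ValiantsHypothesis.Theorems.KPlusLogSqLaw

open Summit.ValiantsHypothesis.ValiantsHypothesis.Theorems.MatrixDescartes.Negative
open scoped BigOperators
open Finset

namespace CyclePotential

variable {m K : ℕ} (d : Fin K → ℕ) (v ε : Fin m → Fin m → Fin K → ℤ)

/-- **Padding.**  A class potential inducing the same strict order as `d` on FULL class maps is `c`-compatible for every `c`: pad the two
class maps on a column set `B` by a common map off `B`. [this file] -/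
theorem compatible_of_univ (u : Fin K → ℤ)
    (hu : ∀ f g : Fin m → Fin K, ∑ b, (d (f b) : ℤ) < ∑ b, (d (g b) : ℤ) → ∑ b, u (f b) < ∑ b, u (g b))
    (c : ℕ) (B : Finset (Fin m)) (_hB : B.card ≤ c) (f g : Fin m → Fin K)
    (hlt : ∑ b ∈ B, (d (f b) : ℤ) < ∑ b ∈ B, (d (g b) : ℤ)) :
    ∑ b ∈ B, u (f b) < ∑ b ∈ B, u (g b) := by
  classical
  -- pad `g` by `f` off `B`
  set g' : Fin m → Fin K := fun b => if b ∈ B then g b else f b with hg'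
  have hsplit : ∀ (w : Fin K → ℤ), ∑ b, w (g' b) = ∑ b ∈ B, w (g b) + ∑ b ∈ univ \ B, w (f b) := by
    intro w
    rw [← sum_inter_add_sum_sdiff univ B (fun b => w (g' b)), univ_inter]
    congr 1
    · exact sum_congr rfl fun b hb => by rw [hg']; simp only [if_pos hb]
    · exact sum_congr rfl fun b hb => by rw [hg']; simp only [if_neg (mem_sdiff.mp hb).2]
  have hsplitf : ∀ (w : Fin K → ℤ), ∑ b, w (f b) = ∑ b ∈ B, w (f b) + ∑ b ∈ univ \ B, w (f b) := by
    intro w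
    rw [← sum_inter_add_sum_sdiff univ B (fun b => w (f b)), univ_inter]
  have h1 : ∑ b, (d (f b) : ℤ) < ∑ b, (d (g' b) : ℤ) := by
    rw [hsplit (fun l => (d l : ℤ)), hsplitf (fun l => (d l : ℤ))]
    linarith
  have h2 := hu f g' h1
  rw [hsplit u, hsplitf u] at h2
  linarith

/-- **THE DEGREE BOUND IS AN ORDER-TYPE INVARIANT.**  In ANY design, every chain of terms dominant at strictly increasing slopes with
consecutive terms distinct has `n ≤ m·(U₁ − U₀)` for every class potential `u` with values in `[U₀, U₁]` that induces the same strict order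
as `d` on full class maps (the cycle potential law at `c = m`, where the orbit hypothesis is void). [this file] -/
theorem chain_le_orderType (u : Fin K → ℤ)
    (hu : ∀ f g : Fin m → Fin K, ∑ b, (d (f b) : ℤ) < ∑ b, (d (g b) : ℤ) → ∑ b, u (f b) < ∑ b, u (g b))
    (U₀ U₁ : ℤ) (hU : ∀ l, U₀ ≤ u l ∧ u l ≤ U₁)
    {n : ℕ} (θ : Fin (n + 1) → ℤ) (p : Fin (n + 1) → Equiv.Perm (Fin m) × (Fin m → Fin K))
    (hθ : StrictMono θ) (hdom : ∀ k, IsDominant d v ε (θ k) (p k)) (hne : ∀ k : Fin n, p k.castSucc ≠ p k.succ) :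
    (n : ℤ) ≤ m * (U₁ - U₀) :=
  chain_le d v ε m u (compatible_of_univ d u hu m) U₀ U₁ hU θ p hθ hdom hne
    fun _ b => ⟨univ, mem_univ b, by rw [card_univ, Fintype.card_fin], fun x => by simp⟩

/-- **Sign-alternating form** (hypothesis list of `TropicalCensus.TropRootLawAt`). [this file] -/
theorem chain_le_orderType_alt (u : Fin K → ℤ)
    (hu : ∀ f g : Fin m → Fin K, ∑ b, (d (f b) : ℤ) < ∑ b, (d (g b) : ℤ) → ∑ b, u (f b) < ∑ b, u (g b))
    (U₀ U₁ : ℤ) (hU : ∀ l, U₀ ≤ u l ∧ u l ≤ U₁)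
    {n : ℕ} (θ : Fin (n + 1) → ℤ) (p : Fin (n + 1) → Equiv.Perm (Fin m) × (Fin m → Fin K))
    (hθ : StrictMono θ) (hdom : ∀ k, IsDominant d v ε (θ k) (p k))
    (halt : ∀ k : Fin n, termSign ε (p k.castSucc) * termSign ε (p k.succ) < 0) :
    (n : ℤ) ≤ m * (U₁ - U₀) :=
  chain_le_orderType d v ε u hu U₀ U₁ hU θ p hθ hdom (ne_of_alt ε p halt)

/-- **Census currency.**  `DesignRowD d v ε (m·H)` for every design whose exponent vector admits an order-equivalent class potential of
height `H` (values in `[U₀, U₀ + H]`). [this file] -/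
theorem designRowD_orderType (u : Fin K → ℤ)
    (hu : ∀ f g : Fin m → Fin K, ∑ b, (d (f b) : ℤ) < ∑ b, (d (g b) : ℤ) → ∑ b, u (f b) < ∑ b, u (g b))
    (U₀ : ℤ) (H : ℕ) (hU : ∀ l, U₀ ≤ u l ∧ u l ≤ U₀ + H) :
    DesignRowD d v ε (m * H) := by
  intro n θ p hθ hdom hne
  have h := chain_le_orderType d v ε u hu U₀ (U₀ + H) hU θ p hθ hdom hne
  have h' : (n : ℤ) ≤ ((m * H : ℕ) : ℤ) := by push_cast; linarith
  exact_mod_cast h'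

/-- The case `u = d`: the tree's degree bound `n ≤ m·(D₁ − D₀)` for exponents in `[D₀, D₁]`, here in `DesignRowD` currency, as the trivial
order-equivalent vector (calibration of the statement; cf. `chain_le_mul_spread`, …TropicalBThinRanges). [folklore] -/
theorem designRowD_spread (D₀ D₁ : ℕ) (hd : ∀ l, D₀ ≤ d l ∧ d l ≤ D₁) : DesignRowD d v ε (m * (D₁ - D₀)) := by
  rcases Nat.eq_zero_or_pos K with hK | hK
  · -- no classes: at most one term (`m = 0`), chains are trivial
    subst hK
    refine designRowD_orderType d v ε (fun l => (d l : ℤ)) (fun f g h => h) 0 (D₁ - D₀) fun l => l.elim0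
  · have h01 : D₀ ≤ D₁ := (hd ⟨0, hK⟩).1.trans (hd ⟨0, hK⟩).2
    refine designRowD_orderType d v ε (fun l => (d l : ℤ)) (fun f g h => h) (D₀ : ℤ) (D₁ - D₀) fun l => ⟨?_, ?_⟩
    · exact_mod_cast (hd l).1
    · have := (hd l).2
      push_cast [Nat.cast_sub h01]
      linarith

/-! ## The law with RESETS: long steps cost exactly their potential drop -/

/-- **CYCLE POTENTIAL LAW WITH RESETS (any design; exact bookkeeping).**  For a `c`-compatible `u` with values in `[U₀, U₁]`, a chain whose
steps outside `J` have orbits of size `≤ c` satisfies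
`n ≤ #J + m·(U₁ − U₀) + Σ_{k ∈ J} (Φ(p_k) − Φ(p_{k+1}))`, `Φ(p) = Σ_b u(class of b)`:
every ordinary step raises `Φ` by `≥ 1`, so the ordinary steps number at most the total budget `m(U₁ − U₀)` plus the total RESET
`Σ_{k∈J} (Φ(p_k) − Φ(p_{k+1}))` bought by the exceptional steps (a negative reset — an exceptional step that raises `Φ` — is paid back).
`chain_le_of_exceptions` (part 2) is the case of the crude reset bound `Φ(p_k) − Φ(p_{k+1}) ≤ m(U₁ − U₀)`.  Located (seat folder py/phi.py,
docstring only): for the GRW `(11,4)` census chain (244 terms) with `u = (0,4,6,7)`, `c = 2`: `#J = 20` (eleven full rotations among them),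
total reset `157`, budget `77`: `223` ordinary steps `≤ 77 + 157 = 234` — the family's quadratic length is the sum of the linearly growing resets
of its rotations; tight `(5,4)` (56 terms, `u = (0,1,4,6)`, `c = 2`): `7 ≤ 7`. [this file] -/
theorem chain_le_resets (c : ℕ) (u : Fin K → ℤ)
    (hu : ∀ B : Finset (Fin m), B.card ≤ c → ∀ f g : Fin m → Fin K,
      ∑ b ∈ B, (d (f b) : ℤ) < ∑ b ∈ B, (d (g b) : ℤ) → ∑ b ∈ B, u (f b) < ∑ b ∈ B, u (g b))
    (U₀ U₁ : ℤ) (hU : ∀ l, U₀ ≤ u l ∧ u l ≤ U₁)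
    {n : ℕ} (θ : Fin (n + 1) → ℤ) (p : Fin (n + 1) → Equiv.Perm (Fin m) × (Fin m → Fin K))
    (hθ : StrictMono θ) (hdom : ∀ k, IsDominant d v ε (θ k) (p k)) (hne : ∀ k : Fin n, p k.castSucc ≠ p k.succ)
    (J : Finset (Fin n))
    (horb : ∀ k : Fin n, k ∉ J → ∀ b : Fin m, ∃ T : Finset (Fin m), b ∈ T ∧ T.card ≤ c ∧
      ∀ x, ((p k.castSucc).1⁻¹ * (p k.succ).1) x ∈ T ↔ x ∈ T) :
    (n : ℤ) ≤ J.card + m * (U₁ - U₀) +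
      ∑ k ∈ J, (∑ b, u ((p k.castSucc).2 b) - ∑ b, u ((p k.succ).2 b)) := by
  classical
  -- ordinary steps climb by one; exceptional steps move by exactly their difference
  have hclimb : ∀ i : ℕ, ∀ hi : i ≤ n,
      (∑ b, u ((p 0).2 b)) + ((univ.filter fun k : Fin n => (k : ℕ) < i ∧ k ∉ J).card : ℤ) +
        ∑ k ∈ J.filter (fun k : Fin n => (k : ℕ) < i), (∑ b, u ((p k.succ).2 b) - ∑ b, u ((p k.castSucc).2 b)) ≤
        ∑ b, u ((p ⟨i, Nat.lt_succ_of_le hi⟩).2 b) := by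
    intro i
    induction i with
    | zero =>
      intro hi
      have h0 : (univ.filter fun k : Fin n => (k : ℕ) < 0 ∧ k ∉ J) = ∅ := by
        ext k; simp
      have h0' : (J.filter fun k : Fin n => (k : ℕ) < 0) = ∅ := by
        ext k; simp
      rw [h0, h0']
      simp
    | succ i ih =>
      intro hi
      have h1 := ih (Nat.le_of_succ_le hi)
      have hk : (⟨i, by omega⟩ : Fin (n + 1)) = (⟨i, by omega⟩ : Fin n).castSucc := rfl
      have hk' : (⟨i + 1, Nat.lt_succ_of_le hi⟩ : Fin (n + 1)) = (⟨i, by omega⟩ : Fin n).succ := rfl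
      by_cases hiJ : (⟨i, by omega⟩ : Fin n) ∈ J
      · -- exceptional step: the ordinary counter stays, the reset sum gains exactly the difference
        have hA : (univ.filter fun k : Fin n => (k : ℕ) < i + 1 ∧ k ∉ J) =
            (univ.filter fun k : Fin n => (k : ℕ) < i ∧ k ∉ J) := by
          ext k
          simp only [mem_filter, mem_univ, true_and]
          constructor
          · rintro ⟨hk1, hk2⟩
            refine ⟨?_, hk2⟩
            rcases Nat.lt_succ_iff_lt_or_eq.mp hk1 with h | h
            · exact h
            · exact absurd (show k = ⟨i, by omega⟩ from Fin.ext h) (fun he => hk2 (he ▸ hiJ))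
          · rintro ⟨hk1, hk2⟩
            exact ⟨Nat.lt_succ_of_lt hk1, hk2⟩
        have hB : (J.filter fun k : Fin n => (k : ℕ) < i + 1) =
            insert (⟨i, by omega⟩ : Fin n) (J.filter fun k : Fin n => (k : ℕ) < i) := by
          ext k
          simp only [mem_filter, mem_insert, Fin.ext_iff]
          constructor
          · rintro ⟨hkJ, hk⟩
            rcases Nat.lt_succ_iff_lt_or_eq.mp hk with h | h
            · exact Or.inr ⟨hkJ, h⟩
            · exact Or.inl h
          · rintro (h | ⟨hkJ, hk⟩)
            · exact ⟨by rw [show k = ⟨i, by omega⟩ from Fin.ext h]; exact hiJ, by omega⟩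
            · exact ⟨hkJ, Nat.lt_succ_of_lt hk⟩
        have hnot : (⟨i, by omega⟩ : Fin n) ∉ (J.filter fun k : Fin n => (k : ℕ) < i) := by
          simp
        rw [hA, hB, sum_insert hnot, ← hk, ← hk']
        linarith
      · -- ordinary step: the counter gains one, the potential climbs by at least one
        have hA : (univ.filter fun k : Fin n => (k : ℕ) < i + 1 ∧ k ∉ J) =
            insert (⟨i, by omega⟩ : Fin n) (univ.filter fun k : Fin n => (k : ℕ) < i ∧ k ∉ J) := by
          ext k
          simp only [mem_filter, mem_univ, true_and, mem_insert, Fin.ext_iff]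
          constructor
          · rintro ⟨hk1, hk2⟩
            rcases Nat.lt_succ_iff_lt_or_eq.mp hk1 with h | h
            · exact Or.inr ⟨h, hk2⟩
            · exact Or.inl h
          · rintro (h | ⟨hk1, hk2⟩)
            · exact ⟨by simp [h], by rw [show k = ⟨i, by omega⟩ from Fin.ext h]; exact hiJ⟩
            · exact ⟨Nat.lt_succ_of_lt hk1, hk2⟩
        have hnot : (⟨i, by omega⟩ : Fin n) ∉ (univ.filter fun k : Fin n => (k : ℕ) < i ∧ k ∉ J) := by
          simp
        have hB : (J.filter fun k : Fin n => (k : ℕ) < i + 1) = (J.filter fun k : Fin n => (k : ℕ) < i) := by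
          ext k
          simp only [mem_filter]
          constructor
          · rintro ⟨hkJ, hk⟩
            refine ⟨hkJ, ?_⟩
            rcases Nat.lt_succ_iff_lt_or_eq.mp hk with h | h
            · exact h
            · exact absurd (show k = ⟨i, by omega⟩ from Fin.ext h) (fun he => hiJ (he ▸ hkJ))
          · rintro ⟨hkJ, hk⟩
            exact ⟨hkJ, Nat.lt_succ_of_lt hk⟩
        have hstep := potential_step d v ε c u hu (hθ (Fin.castSucc_lt_succ (i := ⟨i, by omega⟩)))
          (hdom _) (hdom _) (hne ⟨i, by omega⟩) (horb ⟨i, by omega⟩ hiJ)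
        rw [← hk, ← hk'] at hstep
        rw [hA, hB, card_insert_of_notMem hnot]
        push_cast
        linarith
  have hlast := hclimb n le_rfl
  -- at `i = n`: the ordinary counter is `n − #J`, the reset sum runs over all of `J`
  have hA : (univ.filter fun k : Fin n => (k : ℕ) < n ∧ k ∉ J) = univ \ J := by
    ext k
    simp
  have hB : (J.filter fun k : Fin n => (k : ℕ) < n) = J := by
    ext k
    simp
  rw [hA, hB, card_univ_sdiff, Fintype.card_fin] at hlast
  have hJn : J.card ≤ n := (card_le_univ J).trans (by rw [Fintype.card_fin])
  have hcast : (((n - J.card : ℕ)) : ℤ) = (n : ℤ) - J.card := by push_cast [Nat.cast_sub hJn]; ring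
  rw [hcast] at hlast
  have hends := potential_drop_le u U₀ U₁ hU ((p ⟨n, Nat.lt_succ_self n⟩).2) ((p 0).2)
  have hsum : ∑ k ∈ J, (∑ b, u ((p k.castSucc).2 b) - ∑ b, u ((p k.succ).2 b)) =
      -∑ k ∈ J, (∑ b, u ((p k.succ).2 b) - ∑ b, u ((p k.castSucc).2 b)) := by
    rw [← sum_neg_distrib]
    exact sum_congr rfl fun k _ => by ring
  rw [hsum]
  linarith

end CyclePotential

end Summit.ValiantsHypothesis.ValiantsHypothesis.Theorems.KPlusLogSqLaw
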